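import Mathlib
import HarnessLib

/-!
# Gurvits' univariate capacity lemma

The one-variable inequality at the heart of L. Gurvits' proof of the van der Waerden
conjecture (Electron. J. Combin. 15 (2008) R66, Lemma 3.2, the "`G(k)`" inequality; exposition:
M. Laurent, A. Schrijver, Amer. Math. Monthly 117 (2010) 903–911, Lemma 1):

> Let `R ∈ ℝ[t]` have nonnegative coefficients, degree `≤ K` (`K ≥ 1`) and only real (complex)
> roots, and suppose `c · t ≤ R(t)` for all real `t > 0` (i.e. `c ≤ inf_{t>0} R(t)/t`, the
> univariate *capacity* bound). Then `c · ((K-1)/K)^{K-1} ≤ R'(0) = coeff₁ R`.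

(For `K = 1` the factor `((K-1)/K)^{K-1}` is `0^0 = 1`.)

## Proof route

If `c ≤ 0` there is nothing to prove (`coeff₁ R ≥ 0`). Let `c > 0`.
* If `R(0) = 0` then `R = X · S`, `coeff₁ R = S(0)` and `c ≤ S(t)` for all `t > 0`, so
  `c ≤ S(0)` by continuity; and the Gurvits factor is `≤ 1`.
* If `r₀ := R(0) > 0`: `R` splits over `ℂ` with real roots, hence splits over `ℝ`
  (`Polynomial.Splits.of_splits_map_of_injective`); its roots `z` are negative because
  `R > 0` on `[0, ∞)`. Writing `b_z := 1/(-z) > 0` and `B := ∑_z b_z` one gets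
  `R(t) = r₀ ∏_z (1 + b_z t)` and `coeff₁ R = R'(0) = r₀ B`
  (`Polynomial.Splits.eval_derivative_eq_eval_mul_sum`). By AM–GM on the `≤ K` factors
  `1 + b_z t` padded with ones, `R(t) ≤ r₀ (1 + B t / K)^K` for `t ≥ 0`. For `K = 1` this gives
  `c ≤ r₀ B`; for `K ≥ 2` evaluate at `t⋆ = K / ((K-1) B)`.

## What is NOT here

Only the univariate lemma. The multivariate capacity theorem (Gurvits 2008, Thm 2.3:
`cap(∂p/∂zₙ |_{zₙ=0}) ≥ G(k) cap(p)` for stable `p` with nonnegative coefficients) and the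
van der Waerden / Schrijver–Valiant consequences for permanents are assembled elsewhere from this
lemma and the stability library `Literature.Combinatorics.StablePolynomials.*`.

## References

* L. Gurvits, *Van der Waerden/Schrijver–Valiant like conjectures and stable (aka hyperbolic)
  homogeneous polynomials: one theorem for all*, Electron. J. Combin. 15 (2008) R66, Lemma 3.2.
  [Gurvits2008]
* M. Laurent, A. Schrijver, *On Leonid Gurvits's proof for permanents*, Amer. Math. Monthly 117
  (2010) 903–911, Lemma 1. [LaurentSchrijver2010]
-/

noncomputable section

open scoped BigOperators
open Polynomial

namespace Literature.Combinatorics.StablePolynomials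

namespace Gurvits

/-- **AM–GM in product form** (`Finset` version): for nonnegative reals `z_i` indexed by a
nonempty finite set `s` with `n` elements, `∏ z_i ≤ ((∑ z_i)/n)^n`. From Mathlib's weighted AM–GM
`Real.geom_mean_le_arith_mean_weighted` with equal weights `1/n`. [folklore] -/
theorem finset_prod_le_arith_mean_pow {ι : Type*} (s : Finset ι) (z : ι → ℝ)
    (hz : ∀ i ∈ s, 0 ≤ z i) (hs : s.Nonempty) :
    ∏ i ∈ s, z i ≤ ((∑ i ∈ s, z i) / s.card) ^ s.card := by
  have hn0 : s.card ≠ 0 := hs.card_pos.ne'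
  have hn : (0 : ℝ) < s.card := by exact_mod_cast hs.card_pos
  have hw := Real.geom_mean_le_arith_mean_weighted s (fun _ => (s.card : ℝ)⁻¹) z
    (fun _ _ => inv_nonneg.mpr hn.le)
    (by rw [Finset.sum_const, nsmul_eq_mul, mul_inv_cancel₀ hn.ne']) hz
  have hprod : ∏ i ∈ s, z i = (∏ i ∈ s, z i ^ ((s.card : ℝ)⁻¹)) ^ s.card := by
    rw [← Finset.prod_pow]
    exact Finset.prod_congr rfl fun i hi => (Real.rpow_inv_natCast_pow (hz i hi) hn0).symm
  rw [hprod]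
  refine pow_le_pow_left₀ (Finset.prod_nonneg fun i hi => Real.rpow_nonneg (hz i hi) _)
    (hw.trans_eq ?_) _
  rw [← Finset.mul_sum, inv_mul_eq_div]

/-- **AM–GM in product form** (`Multiset` version): for a nonempty multiset `m` of nonnegative
reals, `∏ m ≤ ((∑ m)/|m|)^|m|`. [folklore] -/
theorem multiset_prod_le_arith_mean_pow (m : Multiset ℝ) (hm : ∀ z ∈ m, 0 ≤ z) (h0 : m ≠ 0) :
    m.prod ≤ (m.sum / Multiset.card m) ^ Multiset.card m := by
  classical
  rw [Multiset.prod_eq_prod_toEnumFinset, Multiset.sum_eq_sum_toEnumFinset,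
    ← Multiset.card_toEnumFinset]
  refine finset_prod_le_arith_mean_pow _ _
    (fun x hx => hm _ (Multiset.mem_of_mem_toEnumFinset hx)) ?_
  rw [← Finset.card_pos, Multiset.card_toEnumFinset]
  exact Multiset.card_pos.mpr h0

/-- **Padded AM–GM**: for nonnegative reals `b ∈ s` (a multiset with at most `K` elements,
`K ≥ 1`) and `t ≥ 0`, `∏_{b ∈ s} (1 + b t) ≤ (1 + (∑ s) t / K)^K` (AM–GM applied to the factors
`1 + b t` padded with `K - |s|` ones). [folklore] -/
theorem multiset_prod_one_add_mul_le_pow (s : Multiset ℝ) (hs : ∀ b ∈ s, 0 ≤ b) {K : ℕ}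
    (hK : 1 ≤ K) (hsK : Multiset.card s ≤ K) {t : ℝ} (ht : 0 ≤ t) :
    (s.map fun b => 1 + b * t).prod ≤ (1 + s.sum * t / K) ^ K := by
  have hK0 : (K : ℝ) ≠ 0 := Nat.cast_ne_zero.mpr (by omega)
  set m : Multiset ℝ := (s.map fun b => 1 + b * t) + Multiset.replicate (K - Multiset.card s) 1
    with hm
  have hcard : Multiset.card m = K := by
    simp [hm, Nat.add_sub_cancel' hsK]
  have hprod : m.prod = (s.map fun b => 1 + b * t).prod := by simp [hm]
  have hsum : m.sum = K + s.sum * t := by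
    simp only [hm, Multiset.sum_add, Multiset.sum_map_add, Multiset.map_const',
      Multiset.sum_replicate, nsmul_eq_mul, mul_one, Multiset.sum_map_mul_right,
      Multiset.map_id', Nat.cast_sub hsK]
    ring
  have hm0 : m ≠ 0 := by
    intro h
    rw [h, Multiset.card_zero] at hcard
    omega
  have hnonneg : ∀ z ∈ m, 0 ≤ z := by
    intro z hz
    rcases Multiset.mem_add.mp hz with hz | hz
    · obtain ⟨b, hb, rfl⟩ := Multiset.mem_map.mp hz
      have := hs b hb
      positivity
    · rw [Multiset.eq_of_mem_replicate hz]
      exact zero_le_one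
  have key := multiset_prod_le_arith_mean_pow m hnonneg hm0
  rw [hprod, hsum, hcard] at key
  have e : (1 + s.sum * t / K) = ((K : ℝ) + s.sum * t) / K := by
    field_simp
  rw [e]
  exact key

/-- A real polynomial with nonnegative coefficients is bounded below on `[0, ∞)` by its constant
coefficient. [folklore] -/
theorem coeff_zero_le_eval_of_coeff_nonneg (R : ℝ[X]) (h : ∀ k, 0 ≤ R.coeff k) {t : ℝ}
    (ht : 0 ≤ t) : R.coeff 0 ≤ R.eval t := by
  rw [Polynomial.eval_eq_sum_range]
  calc R.coeff 0 = R.coeff 0 * t ^ 0 := by simp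
    _ ≤ ∑ i ∈ Finset.range (R.natDegree + 1), R.coeff i * t ^ i :=
      Finset.single_le_sum (f := fun i => R.coeff i * t ^ i)
        (fun i _ => mul_nonneg (h i) (pow_nonneg ht i)) (Finset.mem_range.mpr (Nat.succ_pos _))

/-- If `c t ≤ a + b t` for every real `t > 0`, then `c ≤ b` (let `t → ∞`). [folklore] -/
theorem le_of_forall_pos_mul_le_add_mul {a b c : ℝ} (h : ∀ t : ℝ, 0 < t → c * t ≤ a + b * t) :
    c ≤ b := by
  by_contra! hlt
  have hε : 0 < c - b := sub_pos.mpr hlt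
  set t : ℝ := (|a| + 1) / (c - b) with ht_def
  have ht : 0 < t := div_pos (by positivity) hε
  have e1 : (c - b) * t = |a| + 1 := by
    rw [ht_def]
    field_simp
  have := h t ht
  linarith [le_abs_self a]

/-- **Gurvits' univariate capacity lemma** (Gurvits 2008, Lemma 3.2; Laurent–Schrijver 2010,
Lemma 1). Let `R ∈ ℝ[t]` have nonnegative coefficients, `deg R ≤ K` with `K ≥ 1`, and only real
roots (every complex root `t` of `R` has `Im t = 0`; in particular `R ≠ 0`), and assume
`c · t ≤ R(t)` for all real `t > 0`. Then `c · ((K-1)/K)^{K-1} ≤ coeff₁ R (= R'(0))`.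
For `K = 1` the factor is `(0/1)^0 = 1`. [cite: Gurvits2008, Lemma 3.2] -/
theorem coeff_one_ge_of_realRooted :
    ∀ (K : ℕ) (R : Polynomial ℝ) (c : ℝ), 1 ≤ K → R.natDegree ≤ K → (∀ k, 0 ≤ R.coeff k) →
      (∀ t : ℂ, (R.map (algebraMap ℝ ℂ)).eval t = 0 → t.im = 0) →
      (∀ t : ℝ, 0 < t → c * t ≤ R.eval t) →
      c * (((K : ℝ) - 1) / K) ^ (K - 1) ≤ R.coeff 1 := by
  intro K R c hK hdeg hcoef hroots hct
  have hK0 : (0 : ℝ) < K := by exact_mod_cast hK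
  have hK1 : (1 : ℝ) ≤ K := by exact_mod_cast hK
  have hGnn : 0 ≤ ((K : ℝ) - 1) / K := div_nonneg (sub_nonneg.mpr hK1) hK0.le
  have hG0 : 0 ≤ (((K : ℝ) - 1) / K) ^ (K - 1) := pow_nonneg hGnn _
  have hG1 : (((K : ℝ) - 1) / K) ^ (K - 1) ≤ 1 :=
    pow_le_one₀ hGnn (div_le_one_of_le₀ (by linarith) hK0.le)
  have h1 : 0 ≤ R.coeff 1 := hcoef 1
  rcases le_or_gt c 0 with hc | hc
  · exact (mul_nonpos_of_nonpos_of_nonneg hc hG0).trans h1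
  -- from now on `0 < c`
  by_cases h0 : R.coeff 0 = 0
  · -- `R = X * S`: `coeff₁ R = S(0) ≥ c` by continuity
    obtain ⟨S, hS⟩ := Polynomial.X_dvd_iff.mpr h0
    have hS1 : R.coeff 1 = S.eval 0 := by
      rw [hS, Polynomial.coeff_X_mul, Polynomial.coeff_zero_eq_eval_zero]
    have hcS : ∀ t : ℝ, 0 < t → c ≤ S.eval t := by
      intro t ht
      have := hct t ht
      rw [hS, Polynomial.eval_mul, Polynomial.eval_X] at this
      nlinarith
    have hlim : Filter.Tendsto (fun t => S.eval t) (nhdsWithin 0 (Set.Ioi 0))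
        (nhds (S.eval 0)) :=
      S.continuous.continuousAt.tendsto.mono_left nhdsWithin_le_nhds
    have hcS0 : c ≤ S.eval 0 :=
      ge_of_tendsto hlim (eventually_nhdsWithin_of_forall fun t ht => hcS t ht)
    calc c * (((K : ℝ) - 1) / K) ^ (K - 1) ≤ c * 1 := mul_le_mul_of_nonneg_left hG1 hc.le
      _ = c := mul_one c
      _ ≤ R.coeff 1 := hS1 ▸ hcS0
  -- `r₀ := R(0) > 0`
  have hr0 : 0 < R.coeff 0 := lt_of_le_of_ne (hcoef 0) (Ne.symm h0)
  have hpos : ∀ t : ℝ, 0 ≤ t → 0 < R.eval t := fun t ht =>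
    hr0.trans_le (coeff_zero_le_eval_of_coeff_nonneg R hcoef ht)
  -- `R` splits over `ℝ`
  have hsplit : R.Splits := by
    refine Polynomial.Splits.of_splits_map_of_injective (algebraMap ℝ ℂ).injective
      (IsAlgClosed.splits _) fun a ha => ?_
    have him : a.im = 0 := hroots a (Polynomial.mem_roots'.mp ha).2.eq_zero
    exact ⟨a.re, Complex.ext (by simp) (by simp [him])⟩
  -- the roots are negative
  have hneg : ∀ z ∈ R.roots, z < 0 := by
    intro z hz
    by_contra hz0
    exact (hpos z (not_lt.mp hz0)).ne' (Polynomial.mem_roots'.mp hz).2.eq_zero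
  -- inverse absolute values of the roots, and their sum
  set s : Multiset ℝ := R.roots.map (fun z => 1 / (0 - z)) with hs_def
  have hs0 : ∀ b ∈ s, 0 < b := by
    intro b hb
    obtain ⟨z, hz, rfl⟩ := Multiset.mem_map.mp hb
    have := hneg z hz
    exact one_div_pos.mpr (by linarith)
  have hcard : Multiset.card s ≤ K := by
    rw [hs_def, Multiset.card_map, ← hsplit.natDegree_eq_card_roots]
    exact hdeg
  set B : ℝ := s.sum with hB_def
  have hB0 : 0 ≤ B := Multiset.sum_nonneg fun b hb => (hs0 b hb).le
  -- `coeff₁ R = r₀ * B`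
  have hd : R.derivative.eval 0 = R.eval 0 * B :=
    hsplit.eval_derivative_eq_eval_mul_sum (hpos 0 le_rfl).ne'
  have hcoeff1 : R.coeff 1 = R.coeff 0 * B := by
    have e : R.coeff 1 = R.derivative.eval 0 := by
      rw [← Polynomial.coeff_zero_eq_eval_zero, Polynomial.coeff_derivative]
      simp
    rw [e, hd, ← Polynomial.coeff_zero_eq_eval_zero]
  -- `R(t) = r₀ * ∏ (1 + b t)`
  have hprod : ∀ t : ℝ, R.eval t = R.coeff 0 * (s.map fun b => 1 + b * t).prod := by
    intro t
    rw [Polynomial.coeff_zero_eq_eval_zero, hsplit.eval_eq_prod_roots t,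
      hsplit.eval_eq_prod_roots 0, hs_def, Multiset.map_map, mul_assoc, ← Multiset.prod_map_mul]
    congr 1
    refine congr_arg _ (Multiset.map_congr rfl fun z hz => ?_)
    have hz' : (0 : ℝ) - z ≠ 0 := by have := hneg z hz; linarith
    simp only [Function.comp_apply]
    field_simp
    ring
  -- AM–GM: `c t ≤ R(t) ≤ r₀ (1 + B t / K)^K` for `t > 0`
  have hbound : ∀ t : ℝ, 0 < t → c * t ≤ R.coeff 0 * (1 + B * t / K) ^ K := by
    intro t ht
    refine (hct t ht).trans ?_
    rw [hprod t]
    exact mul_le_mul_of_nonneg_left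
      (multiset_prod_one_add_mul_le_pow s (fun b hb => (hs0 b hb).le) hK hcard ht.le) hr0.le
  -- conclusion
  rw [hcoeff1]
  obtain ⟨n, rfl⟩ : ∃ n, K = n + 1 := ⟨K - 1, by omega⟩
  have hcast : ((n + 1 : ℕ) : ℝ) = n + 1 := by push_cast; ring
  simp only [Nat.add_sub_cancel, hcast, add_sub_cancel_right]
  simp only [hcast] at hbound
  rcases Nat.eq_zero_or_pos n with rfl | hn
  · -- `K = 1`
    simp only [pow_zero, mul_one]
    refine le_of_forall_pos_mul_le_add_mul (a := R.coeff 0) fun t ht => ?_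
    have := hbound t ht
    simp only [Nat.cast_zero, zero_add, div_one, pow_one] at this
    linarith
  -- `K = n + 1 ≥ 2`
  have hn0 : (0 : ℝ) < n := by exact_mod_cast hn
  rcases hB0.eq_or_lt with hB | hBpos
  · -- `B = 0`: `R` would be constant, contradicting `c > 0`
    exfalso
    have hc0 : c ≤ 0 := by
      refine le_of_forall_pos_mul_le_add_mul (a := R.coeff 0) fun t ht => ?_
      have := hbound t ht
      rw [← hB] at this
      simpa using this
    linarith
  -- `B > 0`: evaluate at `t⋆ = (n+1)/(n B)`
  set tstar : ℝ := (n + 1) / (n * B) with htstar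
  have htpos : 0 < tstar := by positivity
  have key := hbound tstar htpos
  have hinner : 1 + B * tstar / ((n : ℝ) + 1) = ((n : ℝ) + 1) / n := by
    rw [htstar]
    field_simp
  rw [hinner] at key
  have hq : (((n : ℝ) + 1) / n) ^ n * ((n : ℝ) / (n + 1)) ^ n = 1 := by
    rw [← mul_pow, div_mul_div_comm, mul_comm ((n : ℝ) + 1), div_self (by positivity), one_pow]
  have step1 : c ≤ R.coeff 0 * B * (((n : ℝ) + 1) / n) ^ n := by
    have := (le_div_iff₀ htpos).mpr key
    refine this.trans_eq ?_
    rw [htstar, pow_succ]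
    field_simp
  calc c * ((n : ℝ) / (n + 1)) ^ n
      ≤ R.coeff 0 * B * (((n : ℝ) + 1) / n) ^ n * ((n : ℝ) / (n + 1)) ^ n :=
        mul_le_mul_of_nonneg_right step1 (by positivity)
    _ = R.coeff 0 * B := by rw [mul_assoc, hq, mul_one]

end Gurvits

end Literature.Combinatorics.StablePolynomials
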